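import Summits.ABC.ABC.Theorems.TwistAmplificationSharpModerateLawDeepRegimeCalibrationLemmas

/-!
# Crux `TwistAmplification.SharpModerateLaw` (stmt-ABC-1975), line `deep-moduli-cusp-dispersion`:
the deep-regime law dominates the Mazur–Kane law (calibration of the line's hardest stub)

The line cuts the cusp counting law C⁺′ — pairs `(c₄, c₆)` with `c₄c₆ ≠ 0`, `Δ ≠ 0`, `1728 ∣ c₄³ − c₆²`,
tower-free, dyadic level `M⁺ = max(|c₄|³, |Δ|) ∈ (Y/2, Y]`, full conductor proxy
`N* = ∏_{p ∣ Δ} (p² if p ∣ c₄ else p) ≤ X` (all primes, `2` and `3` included), in the cone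
`X³ ≤ 8Y`, `Y ≤ X^σ` — into three regimes.  Its hardest stub `stub_deepRegime` asserts C⁺′ on the
DEEP regime: thick tube `|c₄³ − c₆²| > 1728·Y^{1/2}` and small simple radical
`r' = ∏_{p ∥ c₄³ − c₆²} p < Y^{1/6}`.  This file certifies that the conclusion of that stub ALONE implies
the route's rank-4 crux `MazurKaneLaw` (for `1 < s < 2`: `#{abc triples, c ≤ N, rad(abc) ≤ c^s}
≪_ε N^{s−1+ε}`, Mazur's question below `2`), exactly as the sibling calibration
`mazurKaneLaw_of_cuspShellLawCone` of the line `syzygy-lattice-half-deep-few-primes`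
(`…MazurKaneCalibration.lean`), whose counted sets `mkSet`/`mkBlock`, trivial bound and halving step
are reused; the Frey-pair facts for the deep-regime set are support file 1/2,
`…DeepRegimeCalibrationLemmas.lean` (`nstar_freyPair_le`: `N* ≤ 2·rad(abc)`, so the budget is
`X = 2N^s`; `simpleRad_freyPair_eq_one`: `r' = 1`; `freyPair_mem_deep`; `two_mul_level_lt`).

The counting (this file).  For a triple with `c = a + b ∈ (N/2, N]`, `N ≥ 16`: the level
`M⁺ = (16A)³ ∈ (27N⁶, 4096N⁶)` (`mcusp_freyPair_bounds`) satisfies `(16A)³ ≤ Y < 2(16A)³` for one of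
the eight levels `Y = 4096N⁶/2ⁿ`, `n < 8` (`2ⁿ ≤ 4096N⁶/(16A)³ < 2ⁿ⁺¹`), all in the cone
`X³ = 8N^{3s} ≤ 8Y`, `Y ≤ 4096N⁶ ≤ (2N^s)^{13}`, and there `Y < 2(16A)³ < 256(abc)⁴` (`two_mul_level_lt`,
`c ≥ 9`) gives the tube.  So the dyadic block `c ∈ (N/2, N]` injects (`freyPair_inj`) into eight
deep-regime sets of size `≤ C·X^{ε/3}(X·Y^{-1/6} + 1) ≤ C·N^ε(2N^{s−1} + 1) ≤ 3C·N^{s−1+ε}` each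
(`ncard_mkBlock_le_of`, with the deep-regime family abstracted as `D`), and the halving induction
(`ncard_mkSet_le_of_block`) gives `MazurKaneLaw` (`mazurKaneLaw_of_deepRegimeLaw`, the registered
calibration sub-goal of stmt-ABC-1975 for this line, used at `σ = 13`, exponent `ε/3`).
-/

noncomputable section

namespace Summit.ABC.ABC.Theorems.SharpModerateLaw.CuspDispersion

open Literature.NumberTheory.DiophantineGeometry (IsABCTriple rad)
open Summit.ABC.ABC.Theses.TwistAmplification (MazurKaneLaw)

/-! ## 1. The block bound and the halving induction -/

/-- **Block bound.** With the deep-regime family abstracted as `D` (obeying the law at `σ = 13`,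
exponent `ε/3`; finite; containing the Frey pairs as in `freyPair_mem_deep`): for `1 < s < 2` there is
`K ≥ 0` with `#mkBlock s N ≤ K·N^{s−1+ε}` for all `N ≥ 16` — budget `X = 2N^s`, eight levels
`Y = 4096N⁶/2ⁿ`, `n < 8`, each set of size `≤ C·N^ε·(2N^{s−1} + 1)`. -/
theorem ncard_mkBlock_le_of {s ε : ℝ} {D : ℝ → ℝ → Set (ℤ × ℤ)} (hs1 : 1 < s) (hs2 : s < 2) (hε : 0 < ε)
    (hlaw : ∃ C : ℝ, ∀ X Y : ℝ, 1 ≤ X → 1 ≤ Y → X ^ 3 ≤ 8 * Y → Y ≤ X ^ (13 : ℝ) →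
        ((D X Y).ncard : ℝ) ≤ C * X ^ (ε / 3) * (X * Y ^ (-(1 / 6 : ℝ)) + 1))
    (hfin : ∀ X Y : ℝ, 1 ≤ Y → (D X Y).Finite)
    (hmem : ∀ (a b : ℕ) (X Y : ℝ), 0 < a → 0 < b → Nat.Coprime a b → 2 * (rad a b (a + b) : ℝ) ≤ X →
        (16 * ((a : ℝ) ^ 2 + a * b + (b : ℝ) ^ 2)) ^ 3 ≤ Y →
        Y < 2 * (16 * ((a : ℝ) ^ 2 + a * b + (b : ℝ) ^ 2)) ^ 3 →
        Y < 256 * ((a : ℝ) * b * (a + b)) ^ 4 → freyPair a b ∈ D X Y) :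
    ∃ K : ℝ, 0 ≤ K ∧ ∀ N : ℕ, 16 ≤ N → ((mkBlock s N).ncard : ℝ) ≤ K * (N : ℝ) ^ (s - 1 + ε) := by
  obtain ⟨C₀, hC₀⟩ := hlaw
  set C : ℝ := max C₀ 0 with hC
  have hC0 : 0 ≤ C := le_max_right _ _
  have hCC : C₀ ≤ C := le_max_left _ _
  refine ⟨24 * C, by positivity, fun N hN => ?_⟩
  have hs0 : 0 ≤ s := by linarith
  have hN2 : (2 : ℝ) ≤ N := by exact_mod_cast (show 2 ≤ N by omega)
  have hN1 : (1 : ℝ) ≤ N := by linarith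
  have hN0 : (0 : ℝ) ≤ N := by linarith
  have hNpos : (0 : ℝ) < N := by linarith
  set X : ℝ := 2 * (N : ℝ) ^ s with hX
  set Y₁ : ℝ := 4096 * (N : ℝ) ^ 6 with hY₁
  have hNs1 : 1 ≤ (N : ℝ) ^ s := Real.one_le_rpow hN1 hs0
  have hX1 : 1 ≤ X := by rw [hX]; linarith
  have hX0 : 0 ≤ X := by linarith
  have hN6 : (1 : ℝ) ≤ (N : ℝ) ^ 6 := one_le_pow₀ hN1
  have hY₁pos : 0 < Y₁ := by rw [hY₁]; positivity
  -- rpow bookkeeping at base `N`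
  have hNs2 : (N : ℝ) ^ s ≤ (N : ℝ) ^ 2 := by
    have h := Real.rpow_le_rpow_of_exponent_le hN1 hs2.le
    rwa [show ((N : ℝ) ^ (2 : ℝ)) = (N : ℝ) ^ 2 from by exact_mod_cast Real.rpow_natCast (N : ℝ) 2] at h
  have hX3 : X ^ 3 ≤ 8 * (N : ℝ) ^ 6 := by
    have h3 : ((N : ℝ) ^ s) ^ 3 ≤ (N : ℝ) ^ 6 := by
      have e : ((N : ℝ) ^ s) ^ 3 = (N : ℝ) ^ (s * 3) := by
        rw [← Real.rpow_natCast ((N : ℝ) ^ s) 3, ← Real.rpow_mul hN0]; norm_num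
      rw [e, show ((N : ℝ) ^ 6) = (N : ℝ) ^ ((6 : ℕ) : ℝ) from (Real.rpow_natCast _ 6).symm]
      exact Real.rpow_le_rpow_of_exponent_le hN1 (by push_cast; linarith)
    have e2 : X ^ 3 = 8 * ((N : ℝ) ^ s) ^ 3 := by rw [hX]; ring
    rw [e2]; linarith
  have hX13 : Y₁ ≤ X ^ (13 : ℝ) := by
    have h2 : (2 : ℝ) ^ (13 : ℝ) = 8192 := by
      rw [show (13 : ℝ) = ((13 : ℕ) : ℝ) by norm_num, Real.rpow_natCast]; norm_num
    have e : X ^ (13 : ℝ) = 8192 * (N : ℝ) ^ (s * 13) := by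
      rw [hX, Real.mul_rpow (by norm_num) (by positivity), h2, ← Real.rpow_mul hN0]
    have h13 : (N : ℝ) ^ ((6 : ℕ) : ℝ) ≤ (N : ℝ) ^ (s * 13) :=
      Real.rpow_le_rpow_of_exponent_le hN1 (by push_cast; linarith)
    rw [Real.rpow_natCast] at h13
    rw [e, hY₁]; linarith
  have hXN3 : X ≤ (N : ℝ) ^ 3 := by
    rw [hX]
    calc 2 * (N : ℝ) ^ s ≤ (N : ℝ) * (N : ℝ) ^ 2 := by gcongr
      _ = (N : ℝ) ^ 3 := by ring
  have hNε : ((N : ℝ) ^ 3) ^ (ε / 3) = (N : ℝ) ^ ε := by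
    rw [← Real.rpow_natCast (N : ℝ) 3, ← Real.rpow_mul hN0]; ring_nf
  have hXε : X ^ (ε / 3) ≤ (N : ℝ) ^ ε := by
    rw [← hNε]; exact Real.rpow_le_rpow hX0 hXN3 (by positivity)
  have hNinv : ((N : ℝ) ^ 6) ^ (-(1 / 6 : ℝ)) = (N : ℝ) ^ (-1 : ℝ) := by
    rw [← Real.rpow_natCast (N : ℝ) 6, ← Real.rpow_mul hN0]; norm_num
  have hXs1 : X * (N : ℝ) ^ (-1 : ℝ) = 2 * (N : ℝ) ^ (s - 1) := by
    rw [hX, mul_assoc, ← Real.rpow_add hNpos]; ring_nf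
  have h1le : (1 : ℝ) ≤ (N : ℝ) ^ (s - 1) := Real.one_le_rpow hN1 (by linarith)
  have hθ : (N : ℝ) ^ ε * (N : ℝ) ^ (s - 1) = (N : ℝ) ^ (s - 1 + ε) := by
    rw [← Real.rpow_add hNpos]; ring_nf
  -- the eight deep-regime sets
  set S : Fin 8 → Set (ℤ × ℤ) := fun i => D X (Y₁ / 2 ^ (i : ℕ)) with hS
  have hYi : ∀ i : Fin 8, 32 * (N : ℝ) ^ 6 ≤ Y₁ / 2 ^ (i : ℕ) ∧ Y₁ / 2 ^ (i : ℕ) ≤ Y₁ := by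
    intro i
    have hi : (i : ℕ) ≤ 7 := Nat.lt_succ_iff.mp i.isLt
    have h2i : (1 : ℝ) ≤ 2 ^ (i : ℕ) := one_le_pow₀ one_le_two
    have h128 : (2 : ℝ) ^ (i : ℕ) ≤ 128 := le_trans (pow_le_pow_right₀ one_le_two hi) (by norm_num)
    have h2pos : (0 : ℝ) < 2 ^ (i : ℕ) := by positivity
    refine ⟨?_, div_le_self hY₁pos.le h2i⟩
    rw [le_div_iff₀ h2pos, hY₁]
    linarith [mul_le_mul_of_nonneg_left h128 (by positivity : (0 : ℝ) ≤ 32 * (N : ℝ) ^ 6)]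
  have hfinS : ∀ i : Fin 8, (S i).Finite := fun i =>
    hfin X (Y₁ / 2 ^ (i : ℕ)) (by linarith [(hYi i).1, hN6])
  -- Step 1: the block injects into the union of the eight sets
  have step1 : (mkBlock s N).ncard ≤ (⋃ i : Fin 8, S i).ncard := by
    refine Set.ncard_le_ncard_of_injOn (fun t => freyPair t.1 t.2.1) (fun t ht => ?_) ?_
      (Set.finite_iUnion hfinS)
    · obtain ⟨a, b, c⟩ := t
      obtain ⟨⟨⟨ha, hb, hsum, hcop⟩, hcN, hrad⟩, hNc⟩ := ht
      simp only at ha hb hsum hcop hcN hrad hNc ⊢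
      subst hsum
      obtain ⟨hlo, hhi⟩ := mcusp_freyPair_bounds ha hb hcN hNc
      have hmeq : (Mcusp (freyPair a b) : ℝ) = (16 * ((a : ℝ) ^ 2 + a * b + (b : ℝ) ^ 2)) ^ 3 := by
        rw [mcusp_freyPair]; push_cast; ring
      rw [hmeq] at hlo hhi
      set m : ℝ := (16 * ((a : ℝ) ^ 2 + a * b + (b : ℝ) ^ 2)) ^ 3 with hmdef
      have hmpos : 0 < m := by linarith
      have hr : 1 ≤ Y₁ / m := by rw [le_div_iff₀ hmpos, hY₁]; linarith
      obtain ⟨n, hn1, hn2⟩ := exists_nat_pow_near hr one_lt_two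
      have hn8 : n < 8 := by
        have h256 : Y₁ / m < (2 : ℝ) ^ 8 := by
          rw [div_lt_iff₀ hmpos, hY₁]; linarith [hlo]
        exact (pow_lt_pow_iff_right₀ one_lt_two).mp (hn1.trans_lt h256)
      refine Set.mem_iUnion.mpr ⟨⟨n, hn8⟩, ?_⟩
      show freyPair a b ∈ D X (Y₁ / 2 ^ n)
      have h2pos : (0 : ℝ) < 2 ^ n := by positivity
      have hc9 : 9 ≤ a + b := by omega
      have hc9R : (9 : ℝ) ≤ (a : ℝ) + b := by exact_mod_cast hc9
      have hradX : 2 * (rad a b (a + b) : ℝ) ≤ X := by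
        have h2 : (((a + b : ℕ) : ℝ)) ^ s ≤ (N : ℝ) ^ s :=
          Real.rpow_le_rpow (Nat.cast_nonneg _) (by exact_mod_cast hcN) hs0
        rw [hX]; linarith [hrad.trans h2]
      have hmY : m ≤ Y₁ / 2 ^ n := by
        rw [le_div_iff₀ h2pos]
        have h := hn1
        rw [le_div_iff₀ hmpos] at h
        linarith
      have hY2m : Y₁ / 2 ^ n < 2 * m := by
        rw [div_lt_iff₀ h2pos]
        have h := hn2
        rw [div_lt_iff₀ hmpos, pow_succ] at h
        linarith
      -- `Y < 2m < 256(abc)⁴` (`two_mul_level_lt`, `c ≥ 9`)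
      exact hmem a b X (Y₁ / 2 ^ n) ha hb hcop hradX hmY hY2m
        (hY2m.trans (two_mul_level_lt (by exact_mod_cast ha) (by exact_mod_cast hb) hc9R))
    · rintro ⟨a, b, c⟩ ⟨⟨⟨ha, hb, hsum, -⟩, -, -⟩, -⟩ ⟨a', b', c'⟩ ⟨⟨⟨ha', hb', hsum', -⟩, -, -⟩, -⟩ h
      simp only at ha hb hsum ha' hb' hsum' h
      obtain ⟨h1, h2⟩ := freyPair_inj ha hb ha' hb' h
      subst h1 h2 hsum hsum'
      rfl
  -- Step 2: union ≤ sum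
  have step2 : (⋃ i : Fin 8, S i).ncard ≤ ∑ i : Fin 8, (S i).ncard := Set.ncard_iUnion_le_of_fintype S
  -- Step 3: each deep-regime set
  have step3 : ∀ i : Fin 8, ((S i).ncard : ℝ) ≤ 3 * C * (N : ℝ) ^ (s - 1 + ε) := by
    intro i
    obtain ⟨hYlo, hYhi⟩ := hYi i
    set Y : ℝ := Y₁ / 2 ^ (i : ℕ) with hY
    have hY1 : 1 ≤ Y := by linarith
    have hYpos : 0 < Y := by linarith
    have hcone1 : X ^ 3 ≤ 8 * Y := by linarith
    have hcone2 : Y ≤ X ^ (13 : ℝ) := hYhi.trans hX13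
    have hlawi := hC₀ X Y hX1 hY1 hcone1 hcone2
    have hmain : X * Y ^ (-(1 / 6 : ℝ)) ≤ 2 * (N : ℝ) ^ (s - 1) := by
      have h1 : Y ^ (-(1 / 6 : ℝ)) ≤ ((N : ℝ) ^ 6) ^ (-(1 / 6 : ℝ)) :=
        Real.rpow_le_rpow_of_nonpos (by positivity) (by linarith) (by norm_num)
      rw [hNinv] at h1
      calc X * Y ^ (-(1 / 6 : ℝ)) ≤ X * (N : ℝ) ^ (-1 : ℝ) := by gcongr
        _ = _ := hXs1
    have hA : 0 ≤ X * Y ^ (-(1 / 6 : ℝ)) := by positivity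
    have hE : 0 ≤ X ^ (ε / 3) := by positivity
    calc ((S i).ncard : ℝ) ≤ C₀ * X ^ (ε / 3) * (X * Y ^ (-(1 / 6 : ℝ)) + 1) := hlawi
      _ ≤ C * X ^ (ε / 3) * (X * Y ^ (-(1 / 6 : ℝ)) + 1) := by gcongr
      _ ≤ C * (N : ℝ) ^ ε * (2 * (N : ℝ) ^ (s - 1) + (N : ℝ) ^ (s - 1)) := by gcongr
      _ = 3 * C * ((N : ℝ) ^ ε * (N : ℝ) ^ (s - 1)) := by ring
      _ = _ := by rw [hθ]
  -- assemble
  calc ((mkBlock s N).ncard : ℝ) ≤ ((⋃ i : Fin 8, S i).ncard : ℝ) := by exact_mod_cast step1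
    _ ≤ ((∑ i : Fin 8, (S i).ncard : ℕ) : ℝ) := by exact_mod_cast step2
    _ = ∑ i : Fin 8, ((S i).ncard : ℝ) := by push_cast; rfl
    _ ≤ ∑ _i : Fin 8, 3 * C * (N : ℝ) ^ (s - 1 + ε) := Finset.sum_le_sum fun i _ => step3 i
    _ = 24 * C * (N : ℝ) ^ (s - 1 + ε) := by
          rw [Finset.sum_const, Finset.card_univ, Fintype.card_fin, nsmul_eq_mul]; push_cast; ring

/-- **The count from the block bound**, by halving induction on `N` (`ncard_mkSet_le_half`, base
`N < 16` by `ncard_mkSet_le_sq`): `#mkSet s N ≤ C·N^{s−1+ε}` for `N ≥ 2`. -/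
theorem ncard_mkSet_le_of_block {s ε K : ℝ} (hs1 : 1 < s) (hε : 0 < ε) (hK0 : 0 ≤ K)
    (hK : ∀ N : ℕ, 16 ≤ N → ((mkBlock s N).ncard : ℝ) ≤ K * (N : ℝ) ^ (s - 1 + ε)) :
    ∃ C : ℝ, ∀ N : ℕ, 2 ≤ N → ((mkSet s N).ncard : ℝ) ≤ C * (N : ℝ) ^ (s - 1 + ε) := by
  set θ : ℝ := s - 1 + ε with hθdef
  have hθ : 0 < θ := by rw [hθdef]; linarith
  set q : ℝ := (2 : ℝ) ^ θ with hq
  have hq1 : 1 < q := Real.one_lt_rpow one_lt_two hθ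
  have hqpos : 0 < q := by linarith
  set K₁ : ℝ := K * q / (q - 1) with hK₁
  have hK₁0 : 0 ≤ K₁ := by rw [hK₁]; exact div_nonneg (by positivity) (by linarith)
  set K₂ : ℝ := ((16 : ℝ) + 1) ^ 2 with hK₂
  have hK₂0 : 0 ≤ K₂ := by positivity
  have halg : K₁ / q + K = K₁ := by
    have hq' : q - 1 ≠ 0 := ne_of_gt (by linarith)
    rw [hK₁]; field_simp; ring
  have key : ∀ N : ℕ, ((mkSet s N).ncard : ℝ) ≤ K₁ * (N : ℝ) ^ θ + K₂ := by
    intro N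
    induction N using Nat.strong_induction_on with
    | _ N ih =>
      have hNθ : 0 ≤ K₁ * (N : ℝ) ^ θ := mul_nonneg hK₁0 (Real.rpow_nonneg (Nat.cast_nonneg N) θ)
      rcases lt_or_ge N 16 with hlt | hge
      · have h := ncard_mkSet_le_sq s N
        have h' : ((mkSet s N).ncard : ℝ) ≤ ((N : ℝ) + 1) ^ 2 := by exact_mod_cast h
        have h'' : ((N : ℝ) + 1) ^ 2 ≤ K₂ := by
          rw [hK₂]; gcongr; exact_mod_cast hlt.le
        linarith
      · have hhalf : ((mkSet s N).ncard : ℝ) ≤ ((mkSet s (N / 2)).ncard : ℝ) + ((mkBlock s N).ncard : ℝ) := by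
          exact_mod_cast ncard_mkSet_le_half s N
        have ih' := ih (N / 2) (Nat.div_lt_self (by omega) one_lt_two)
        have hb := hK N hge
        have hdiv : (((N / 2 : ℕ) : ℝ)) ^ θ ≤ ((N : ℝ) / 2) ^ θ :=
          Real.rpow_le_rpow (Nat.cast_nonneg _) Nat.cast_div_le hθ.le
        have hsplit : ((N : ℝ) / 2) ^ θ = (N : ℝ) ^ θ / q := by
          rw [hq, Real.div_rpow (Nat.cast_nonneg N) zero_le_two]
        calc ((mkSet s N).ncard : ℝ)
            ≤ (K₁ * (((N / 2 : ℕ) : ℝ)) ^ θ + K₂) + K * (N : ℝ) ^ θ := by linarith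
          _ ≤ (K₁ * (((N : ℝ) / 2) ^ θ) + K₂) + K * (N : ℝ) ^ θ := by gcongr
          _ = (K₁ / q + K) * (N : ℝ) ^ θ + K₂ := by rw [hsplit]; ring
          _ = K₁ * (N : ℝ) ^ θ + K₂ := by rw [halg]
  refine ⟨K₁ + K₂, fun N hN => ?_⟩
  have h1 : (1 : ℝ) ≤ (N : ℝ) ^ θ := Real.one_le_rpow (by exact_mod_cast (show 1 ≤ N by omega)) hθ.le
  calc ((mkSet s N).ncard : ℝ) ≤ K₁ * (N : ℝ) ^ θ + K₂ := key N
    _ ≤ K₁ * (N : ℝ) ^ θ + K₂ * (N : ℝ) ^ θ := by nlinarith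
    _ = (K₁ + K₂) * (N : ℝ) ^ θ := by ring

/-! ## 2. The calibration theorem -/

/-- **The deep-regime law implies the Mazur–Kane law.**  The hypothesis is verbatim the conclusion of
the line's hardest stub `stub_deepRegime` (C⁺′ on the deep regime: thick tube, simple radical
`< Y^{1/6}`, in the cone `X³ ≤ 8Y ≤ 8X^σ`, every `σ > 6`); the conclusion is the route's rank-4 crux
`MazurKaneLaw` (`#{abc triples, c ≤ N, rad(abc) ≤ c^s} ≤ C(s,ε)·N^{s−1+ε}` for `1 < s < 2`).
Registered calibration sub-goal `mazurKaneLaw_of_deepRegimeLaw` of stmt-ABC-1975 (line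
`deep-moduli-cusp-dispersion`): used at `σ = 13`, `ε/3`, on the Frey pairs of the triples. -/
theorem mazurKaneLaw_of_deepRegimeLaw :
    (∀ σ : ℝ, 6 < σ → ∀ ε : ℝ, 0 < ε → ∃ C : ℝ, ∀ X Y : ℝ, 1 ≤ X → 1 ≤ Y → X ^ 3 ≤ 8 * Y → Y ≤ X ^ σ → (Set.ncard {x : ℤ × ℤ | (x.1 ≠ 0 ∧ x.2 ≠ 0 ∧ x.1 ^ 3 ≠ x.2 ^ 2 ∧ (1728 : ℤ) ∣ x.1 ^ 3 - x.2 ^ 2 ∧ ((∀ p : ℕ, p.Prime → 5 ≤ p → ¬ ((p : ℤ) ^ 4 ∣ x.1 ∧ (p : ℤ) ^ 6 ∣ x.2)) ∧ ¬ ((2 : ℤ) ^ 8 ∣ x.1 ∧ (2 : ℤ) ^ 11 ∣ x.2) ∧ ¬ ((3 : ℤ) ^ 5 ∣ x.1 ∧ (3 : ℤ) ^ 9 ∣ x.2)) ∧ ((|x.1| ^ 3 : ℤ) : ℝ) ≤ Y ∧ ((|x.1 ^ 3 - x.2 ^ 2| : ℤ) : ℝ) ≤ 1728 * Y ∧ Y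 < 2 * max (((|x.1| ^ 3 : ℤ) : ℝ)) (((|x.1 ^ 3 - x.2 ^ 2| : ℤ) : ℝ) / 1728) ∧ ((∏ p ∈ ((x.1 ^ 3 - x.2 ^ 2) / 1728).natAbs.primeFactors, (if ((p : ℕ) : ℤ) ∣ x.1 then p ^ 2 else p) : ℕ) : ℝ) ≤ X) ∧ (¬ (((|x.1 ^ 3 - x.2 ^ 2| : ℤ) : ℝ) ≤ 1728 * Y ^ (1 / 2 : ℝ)) ∧ ((∏ p ∈ (x.1 ^ 3 - x.2 ^ 2).natAbs.primeFactors.filter (fun p : ℕ => ¬ (((p : ℕ) : ℤ) ^ 2 ∣ x.1 ^ 3 - x.2 ^ 2)), p : ℕ) : ℝ) < Y ^ (1 / 6 : ℝ))} : ℝ) ≤ C * X ^ ε * (X * Y ^ (-(1 / 6 : ℝ)) + 1)) → Summit.ABC.ABC.Theses.TwistAmplification.MazurKaneLaw := by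
  intro hlaw s hs1 hs2 ε hε
  obtain ⟨K, hK0, hK⟩ := ncard_mkBlock_le_of hs1 hs2 hε (hlaw 13 (by norm_num) (ε / 3) (by positivity))
    (fun X Y _ => (box_finite Y).subset fun x hx => ⟨hx.1.2.2.2.2.2.1, hx.1.2.2.2.2.2.2.1⟩)
    (fun a b X Y ha hb hab hX h1 h2 h3 => freyPair_mem_deep ha hb hab hX h1 h2 h3)
  obtain ⟨C, hC⟩ := ncard_mkSet_le_of_block hs1 hε hK0 hK
  exact ⟨C, fun N hN => hC N hN⟩

end Summit.ABC.ABC.Theorems.SharpModerateLaw.CuspDispersion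

end
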